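import Summits.CriticalPhenomena.PercolationContinuityZ3.Theorems.PercNearOneGluingNoHeavyLowerTailSahiTwoLevelIndependentTopsPair
import Summits.CriticalPhenomena.PercolationContinuityZ3.Theorems.PercNearOneGluingNoHeavyLowerTailSahiTwoLevelBernsteinBridge
import Summits.CriticalPhenomena.PercolationContinuityZ3.Theorems.PercNearOneGluingNoHeavyLowerTailSahiCoordinateTwoThirds
import Literature.Probability.LatticeModels.SahiIndependentAtoms

/-!
# Kahn's Conjecture 5 / Sahi's `C_3` for every triple of increasing events two of which SHARE AT MOST ONE COIN —
# a second proof, via the two-level forms, stated on ONE cube `Set ι` with `DeterminedBy` supports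

Companion of `…SahiTwoLevelIndependentTops(Pair)` (cell `prim-bnk`, seat bnk-2 gen 16; `--supports stmt-CriticalPhenomena-4575`;
memo `run/shared/lean/prim/prim-l12/FROM-prim-bnk-2-g16-INDEPENDENT-TOPS.md`).

PRIOR ART IN THE TREE.  The mathematical statement — `E_3(f,g,h) ≥ 0` when `f` and `g` share at most one coordinate and `h` is arbitrary —
is masterthm-p2's THEOREM `SahiSharedTwoPoint.sahiE_three_nonneg_sharedTwoPoint` (SAHI-ROUTE §4.28; capped-ratio identity on `α × β × γ` with
`γ` a two-point chain), with the typed three-cube corollary `SahiSharedTwoPoint.sahiE_three_nonneg_cubes_sharedBit` on `Set A × Set B × Set C`.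
The disjoint-supports case is `Literature.Probability.LatticeModels.prodBernoulli_sahiE3_nonneg_of_determinedBy` ("independent atoms").
WHAT THIS FILE ADDS: (i) a DIFFERENT, short proof through the lane's two-level forms; (ii) the statement on a SINGLE cube `Set ι` under
`bernoulliWeight p` / `prodBernoulli p` with `DeterminedBy` hypotheses (`A` determined by `S₀`, `B` by `S₁`, `S₀ ∩ S₁ ⊆ {e}`, resp.
`(S₀ ∩ S₁).card ≤ 1`), i.e. the form consumed by the rest of the `Set ι` machinery without a transfer to a product of typed cubes:
`sahiE_three_nonneg_of_inter_subset_singleton`, `prodBernoulli_sahiE3_nonneg_of_inter_subset_singleton`,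
`prodBernoulli_sahiE3_nonneg_of_card_inter_le_one`.  Example: `A = x₁ ∨ x₂x₃`, `B = x₁x₄ ∨ x₅`, any increasing `C`, any product measure.

PROOF (new).  Along the shared coin `e` the fibre cubic `Φ(s) = E_3(μ_{p[e↦s]}; A, B, C)` has the Bernstein form
`Φ(s) = (1−s)²·E_3(A⁰,B⁰,C⁰) + s²·E_3(A¹,B¹,C¹) + s(1−s)²·T(U¹,U⁰) + s²(1−s)·T⁺(U¹,U⁰)`
(`SahiCoordinateBernstein.sahiE_three_decomp_coord` + the bridge identities `SahiTwoLevel.coordPiece₁_add_eq_twoLevelForm`,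
`coordPiece₂_add_eq_twoLevelPlus`), where `X^b = secAt e b X` are the sections and `T`, `T⁺` the two-level forms of the nested section triples.  The sections
`A^b`, `B^b` are determined by the DISJOINT sets `S₀ ∖ {e}`, `S₁ ∖ {e}`; hence the two section values of `E_3` are `≥ 0` (independent atoms) and
`T ≥ 0`, `T⁺ ≥ 0` by the independent-tops theorem of this seat (`SahiTwoLevelIndep.twoLevelForm_nonneg_of_determinedBy`,
`twoLevelPlus_nonneg_of_determinedBy`).  All four Bernstein coefficients being nonnegative, `Φ(p_e) ≥ 0`.
Everything proved; axioms standard; Kahn's Conjecture 5 in general remains OPEN (an obligation, never a fact). [this work]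
-/

noncomputable section

open scoped Classical

namespace Summit.CriticalPhenomena.PercolationContinuityZ3.Theorems

namespace SahiTwoLevelIndep

open Finset MeasureTheory
open Literature.Combinatorics.Sahi2008
open Literature.Probability.LatticeModels (prodBernoulli prodBernoulli_sahiE3_nonneg_of_determinedBy)
open Literature.Probability.Percolation (DeterminedBy)
open Literature.Probability.Percolation.DecisionTree (ind)

variable {ι : Type} [Fintype ι]

/-- `E_3` of the `b`-sections of `(A,B,C)` is nonnegative when the sections of `A` and `B` have disjoint supports (independent atoms, transported to
Sahi's functional on indicators). [this work] -/
theorem sahiE_three_secAt_nonneg_of_disjoint (p : ι → unitInterval) (e : ι) (b : Bool) {F F' : Finset ι} (hFF' : Disjoint F F')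
    {A B C : Set (Set ι)} (hA : IsUpperSet A) (hB : IsUpperSet B) (hC : IsUpperSet C)
    (hAF : DeterminedBy (secAt e b A) (↑F : Set ι)) (hBF : DeterminedBy (secAt e b B) (↑F' : Set ι)) :
    0 ≤ sahiE (bernoulliWeight p) 3 ![ind (secAt e b A), ind (secAt e b B), ind (secAt e b C)] := by
  rw [sahiE_three_ind]
  exact prodBernoulli_sahiE3_nonneg_of_determinedBy p hFF' hAF hBF (isUpperSet_secAt e b hA) (isUpperSet_secAt e b hB)
    (isUpperSet_secAt e b hC) MeasurableSet.of_discrete MeasurableSet.of_discrete MeasurableSet.of_discrete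

/-- **KAHN'S CONJECTURE 5 FOR TWO EVENTS SHARING AT MOST ONE COIN** (single-cube `DeterminedBy` form; the statement is masterthm-p2's
`SahiSharedTwoPoint.sahiE_three_nonneg_sharedTwoPoint`, the proof here is new, via the two-level forms).  For every product weight on a finite
cube and increasing events `A, B, C` with `A` determined by `S₀`, `B` determined by `S₁` and `S₀ ∩ S₁ ⊆ {e}`:  `E_3(μ_p; 1_A, 1_B, 1_C) ≥ 0`.
[this work] -/
theorem sahiE_three_nonneg_of_inter_subset_singleton (p : ι → unitInterval) (e : ι) {S₀ S₁ : Finset ι} {A B C : Set (Set ι)}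
    (hA : IsUpperSet A) (hB : IsUpperSet B) (hC : IsUpperSet C)
    (hAS : DeterminedBy A (↑S₀ : Set ι)) (hBS : DeterminedBy B (↑S₁ : Set ι)) (hS : S₀ ∩ S₁ ⊆ {e}) :
    0 ≤ sahiE (bernoulliWeight p) 3 ![ind A, ind B, ind C] := by
  -- the sections are determined by the disjoint sets `S₀ ∖ {e}`, `S₁ ∖ {e}`
  have hdisj : Disjoint (S₀.erase e) (S₁.erase e) := by
    rw [Finset.disjoint_left]
    intro x hx0 hx1
    have hx : x ∈ S₀ ∩ S₁ := Finset.mem_inter.2 ⟨(Finset.mem_erase.1 hx0).2, (Finset.mem_erase.1 hx1).2⟩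
    exact (Finset.mem_erase.1 hx0).1 (Finset.mem_singleton.1 (hS hx))
  have hAsec : ∀ b, DeterminedBy (secAt e b A) (↑(S₀.erase e) : Set ι) := fun b => determinedBy_secAt e b hAS
  have hBsec : ∀ b, DeterminedBy (secAt e b B) (↑(S₁.erase e) : Set ι) := fun b => determinedBy_secAt e b hBS
  -- `E_3` of both section triples is nonnegative (independent atoms)
  have hB0 := sahiE_three_secAt_nonneg_of_disjoint p e false hdisj hA hB hC (hAsec false) (hBsec false)
  have hB3 := sahiE_three_secAt_nonneg_of_disjoint p e true hdisj hA hB hC (hAsec true) (hBsec true)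
  -- the two-level forms of the nested sections are nonnegative (independent tops, `T := S₁ ∖ {e}`)
  have hG : ∀ i, IsUpperSet ((![secAt e true A, secAt e true B, secAt e true C] : Fin 3 → Set (Set ι)) i) := by
    intro i; fin_cases i
    · exact isUpperSet_secAt e true hA
    · exact isUpperSet_secAt e true hB
    · exact isUpperSet_secAt e true hC
  have hH : ∀ i, IsUpperSet ((![secAt e false A, secAt e false B, secAt e false C] : Fin 3 → Set (Set ι)) i) := by
    intro i; fin_cases i
    · exact isUpperSet_secAt e false hA
    · exact isUpperSet_secAt e false hB
    · exact isUpperSet_secAt e false hC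
  have hHG : ∀ i, (![secAt e false A, secAt e false B, secAt e false C] : Fin 3 → Set (Set ι)) i ⊆
      (![secAt e true A, secAt e true B, secAt e true C] : Fin 3 → Set (Set ι)) i := by
    intro i; fin_cases i
    · exact SahiTwoLevel.secAt_false_subset_true e hA
    · exact SahiTwoLevel.secAt_false_subset_true e hB
    · exact SahiTwoLevel.secAt_false_subset_true e hC
  have h0 : DeterminedBy ((![secAt e true A, secAt e true B, secAt e true C] : Fin 3 → Set (Set ι)) 0) (↑(S₁.erase e) : Set ι)ᶜ := by
    refine (hAsec true).mono fun x hx hx1 => ?_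
    exact Finset.disjoint_left.1 hdisj (Finset.mem_coe.1 hx) (Finset.mem_coe.1 hx1)
  have h1 : DeterminedBy ((![secAt e true A, secAt e true B, secAt e true C] : Fin 3 → Set (Set ι)) 1) (↑(S₁.erase e) : Set ι) :=
    hBsec true
  have hT := twoLevelForm_nonneg_of_determinedBy p (S₁.erase e) _ _ hG hH hHG h0 h1
  have hTp := twoLevelPlus_nonneg_of_determinedBy p (S₁.erase e) _ _ hG hH hHG h0 h1
  simp only [← ex_bernoulliWeight_ind] at hT hTp
  -- the one-coordinate Bernstein decomposition and the bridge identities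
  have hdec := SahiCoordinateBernstein.sahiE_three_decomp_coord p e ![A, B, C]
  rw [Pointwise.ind_vec3, SahiCoordinateTwoThirds.ind_secAt_vec3, SahiCoordinateTwoThirds.ind_secAt_vec3] at hdec
  have hb1 := SahiTwoLevel.coordPiece₁_add_eq_twoLevelForm p e A B C
  have hb2 := SahiTwoLevel.coordPiece₂_add_eq_twoLevelPlus p e A B C
  have hT' : 0 ≤ SahiCoordinateBernstein.coordPiece₁ p e ![A, B, C]
      + sahiE (bernoulliWeight p) 3 ![ind (secAt e false A), ind (secAt e false B), ind (secAt e false C)]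
      + sahiE (bernoulliWeight p) 3 ![ind (secAt e true A), ind (secAt e true B), ind (secAt e true C)] := by
    rw [hb1]; exact hT
  have hTp' : 0 ≤ SahiCoordinateBernstein.coordPiece₂ p e ![A, B, C]
      + sahiE (bernoulliWeight p) 3 ![ind (secAt e false A), ind (secAt e false B), ind (secAt e false C)]
      + sahiE (bernoulliWeight p) 3 ![ind (secAt e true A), ind (secAt e true B), ind (secAt e true C)] := by
    rw [hb2]; exact hTp
  rw [hdec]
  have hs0 : 0 ≤ (p e : ℝ) := (p e).2.1
  have hs1 : 0 ≤ 1 - (p e : ℝ) := sub_nonneg.2 (p e).2.2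
  -- `Φ(s) = (1−s)² B₀ + s² B₃ + s(1−s)² T + s²(1−s) T⁺`
  nlinarith [mul_nonneg (mul_nonneg hs1 hs1) hB0, mul_nonneg (mul_nonneg hs0 hs0) hB3,
    mul_nonneg (mul_nonneg hs0 (mul_nonneg hs1 hs1)) hT', mul_nonneg (mul_nonneg (mul_nonneg hs0 hs0) hs1) hTp']

/-- **The same in the measure functional `sahiE3 (prodBernoulli p)`.** [this work] -/
theorem prodBernoulli_sahiE3_nonneg_of_inter_subset_singleton (p : ι → unitInterval) (e : ι) {S₀ S₁ : Finset ι} {A B C : Set (Set ι)}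
    (hA : IsUpperSet A) (hB : IsUpperSet B) (hC : IsUpperSet C)
    (hAS : DeterminedBy A (↑S₀ : Set ι)) (hBS : DeterminedBy B (↑S₁ : Set ι)) (hS : S₀ ∩ S₁ ⊆ {e}) :
    0 ≤ Literature.Probability.LatticeModels.sahiE3 (prodBernoulli p) A B C := by
  rw [← sahiE_three_ind]
  exact sahiE_three_nonneg_of_inter_subset_singleton p e hA hB hC hAS hBS hS

/-- **KAHN'S CONJECTURE 5 WHEN TWO OF THE THREE EVENTS SHARE AT MOST ONE COIN** (`|S₀ ∩ S₁| ≤ 1`; cf. `SahiSharedTwoPoint.sahiE_three_nonneg_cubes_sharedBit`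
for the typed three-cube form): `E_3(μ_p; A, B, C) ≥ 0` for all increasing `A` (determined by `S₀`), `B` (determined by `S₁`) and `C`, under every
product measure on a finite cube. [this work] -/
theorem prodBernoulli_sahiE3_nonneg_of_card_inter_le_one (p : ι → unitInterval) {S₀ S₁ : Finset ι} {A B C : Set (Set ι)}
    (hA : IsUpperSet A) (hB : IsUpperSet B) (hC : IsUpperSet C)
    (hAS : DeterminedBy A (↑S₀ : Set ι)) (hBS : DeterminedBy B (↑S₁ : Set ι)) (hS : (S₀ ∩ S₁).card ≤ 1) :
    0 ≤ Literature.Probability.LatticeModels.sahiE3 (prodBernoulli p) A B C := by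
  rcases Nat.lt_or_ge (S₀ ∩ S₁).card 1 with h0 | h1
  · -- disjoint supports: independent atoms
    have hd : Disjoint S₀ S₁ := Finset.disjoint_iff_inter_eq_empty.2 (Finset.card_eq_zero.1 (by omega))
    exact prodBernoulli_sahiE3_nonneg_of_determinedBy p hd hAS hBS hA hB hC MeasurableSet.of_discrete
      MeasurableSet.of_discrete MeasurableSet.of_discrete
  · -- exactly one shared coin
    obtain ⟨e, he⟩ := Finset.card_eq_one.1 (le_antisymm hS h1)
    exact prodBernoulli_sahiE3_nonneg_of_inter_subset_singleton p e hA hB hC hAS hBS he.le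

end SahiTwoLevelIndep

end Summit.CriticalPhenomena.PercolationContinuityZ3.Theorems
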